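import Summits.QuantumAdvantage.AdviceFreeQNC0.AffBells33StairOps

/-!
# AffBells33 (planner qa-qnc0-p2 g33) — line L3 staircase toolkit, part 2: LEMMA C and LEMMA C⁻ over the reals (§4–§5)

Continuation of `AffBells33StairOps` (statements §1–§2, integer certificates §3): the convex / trilinear extension of the
three-pair `ℓ¹` contraction (`threePairContraction`, W-S2) and the twisted two-coin contraction of mean-zero measures
(`twistedTwoCoinContraction`, W-S3).  See `HOME/qa-qnc0-p2/line33/PROOF-STAIR.md` §3.
Ported to the tree verbatim (split into three files `AffBells33StairOps` §1–§3 / `AffBells33StairContraction` §4–§5 /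
`AffBells33StairChains` §6 for the 400-line rule) by the prover seat qn-prover-3 g20 (landing ask of qa-qnc0-p2 g33, 11:0xZ);
authored and kernel-checked by the planner seat qa-qnc0-p2 g33 (`HOME/qa-qnc0-p2/line33/Sketch33.lean`, 672 l., rc 0 / 0 sorry).
WHAT THIS IS NOT: no crux; THEOREM S (`StaircaseLoss3`) is not proved here (W-S1/W-S4/W-S5 remain).
-/

namespace Summit.QuantumAdvantage.AdviceFreeQNC0

open Finset Literature.Computability.QuantumComplexity Literature.Computability.QuantumComplexity.RingHLF

namespace AffBells33

/-! ## 4. LEMMA C over the reals (W-S2, PROVED): the convex / trilinear extension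

Real signed measures `ZMod 3 → ℝ`; the operators as `ℝ`-linear maps; `vtxL z` is TWICE the vertex block (as `vtx`), `circL q` the general
coin block with coefficient function `q` (`(circL q v)(h) = Σ_a q(a)·v(h − a)`), a COIN BLOCK when `q ≥ 0`, `Σ q = 1`, `q ≤ ½`. -/

/-- `ℓ¹` norm on `ℝ^{ℤ₃}`. -/
def l1R (v : ZMod 3 → ℝ) : ℝ := |v 0| + |v 1| + |v 2|

/-- Integer vectors as real vectors. -/
def castV (v : ZMod 3 → ℤ) : ZMod 3 → ℝ := fun h => (v h : ℝ)

/-- Reflection `R_r` as a linear map. -/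
noncomputable def reflL (r : ZMod 3) : (ZMod 3 → ℝ) →ₗ[ℝ] (ZMod 3 → ℝ) where
  toFun v := fun h => if h = r then -v h else v h
  map_add' v w := by
    funext h; simp only [Pi.add_apply]; split_ifs <;> ring
  map_smul' c v := by
    funext h; simp only [Pi.smul_apply, smul_eq_mul, RingHom.id_apply]; split_ifs <;> ring

/-- Twice the vertex coin block with vanishing coefficient at shift `z`. -/
noncomputable def vtxL (z : ZMod 3) : (ZMod 3 → ℝ) →ₗ[ℝ] (ZMod 3 → ℝ) where
  toFun v := fun h => (v (h - 0) + v (h - 1) + v (h - 2)) - v (h - z)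
  map_add' v w := by
    funext h; simp only [Pi.add_apply]; ring
  map_smul' c v := by
    funext h; simp only [Pi.smul_apply, smul_eq_mul, RingHom.id_apply]; ring

/-- The general circulant `Σ_a q(a) S^a`. -/
noncomputable def circL (q : ZMod 3 → ℝ) : (ZMod 3 → ℝ) →ₗ[ℝ] (ZMod 3 → ℝ) where
  toFun v := fun h => q 0 * v (h - 0) + q 1 * v (h - 1) + q 2 * v (h - 2)
  map_add' v w := by
    funext h; simp only [Pi.add_apply]; ring
  map_smul' c v := by
    funext h; simp only [Pi.smul_apply, smul_eq_mul, RingHom.id_apply]; ring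

/-- Coin blocks: circulant, stochastic, coefficients `≤ ½` (every product of `≥ 1` coins `(I + S^σ)/2` is one). -/
def IsCoinBlock (q : ZMod 3 → ℝ) : Prop := (∀ a, 0 ≤ q a) ∧ q 0 + q 1 + q 2 = 1 ∧ ∀ a, q a ≤ 1 / 2

/-- The `ℓ¹` norm is non-negative. -/
theorem l1R_nonneg (v : ZMod 3 → ℝ) : 0 ≤ l1R v := by unfold l1R; positivity

/-- The `ℓ¹` norm of `0`. -/
theorem l1R_zero : l1R 0 = 0 := by simp [l1R]

/-- Triangle inequality for `l1R`. -/
theorem l1R_add_le (v w : ZMod 3 → ℝ) : l1R (v + w) ≤ l1R v + l1R w := by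
  simp only [l1R, Pi.add_apply]
  linarith [abs_add_le (v 0) (w 0), abs_add_le (v 1) (w 1), abs_add_le (v 2) (w 2)]

/-- Homogeneity of `l1R`. -/
theorem l1R_smul (c : ℝ) (v : ZMod 3 → ℝ) : l1R (c • v) = |c| * l1R v := by
  simp only [l1R, Pi.smul_apply, smul_eq_mul, abs_mul]; ring

/-- `l1R` of a finite sum is at most the sum of the norms. -/
theorem l1R_sum_le {ι : Type*} (s : Finset ι) (f : ι → ZMod 3 → ℝ) : l1R (∑ i ∈ s, f i) ≤ ∑ i ∈ s, l1R (f i) :=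
  Finset.le_sum_of_subadditive l1R l1R_zero.le l1R_add_le s f

/-- Sums over `ℤ₃`, spelled out (the `Fin 3` lemma up to the `ZMod 3` instance path). -/
theorem sum_zmod3 (f : ZMod 3 → ℝ) : ∑ h : ZMod 3, f h = f 0 + f 1 + f 2 := Fin.sum_univ_three f

/-- `l1R` of an integer vector is its integer `ℓ¹` norm. -/
theorem l1R_castV (v : ZMod 3 → ℤ) : l1R (castV v) = (l1 v : ℝ) := by
  simp [l1R, l1, castV]

/-- `l1R` as a `Finset` sum. -/
theorem l1R_eq_sum (v : ZMod 3 → ℝ) : l1R v = ∑ h : ZMod 3, |v h| := by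
  rw [sum_zmod3 (fun h => |v h|)]; rfl

/-- `reflL` on integer vectors is `refl`. -/
theorem reflL_castV (r : ZMod 3) (v : ZMod 3 → ℤ) : reflL r (castV v) = castV (refl r v) := by
  funext h
  simp only [reflL, LinearMap.coe_mk, AddHom.coe_mk, castV, refl]
  split_ifs <;> push_cast <;> ring

/-- `vtxL` on integer vectors is `vtx`. -/
theorem vtxL_castV (z : ZMod 3) (v : ZMod 3 → ℤ) : vtxL z (castV v) = castV (vtx z v) := by
  funext h
  simp only [vtxL, LinearMap.coe_mk, AddHom.coe_mk, castV, vtx]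
  push_cast; ring

/-- Basis expansion. -/
theorem eq_sum_basis (v : ZMod 3 → ℝ) : v = ∑ h : ZMod 3, v h • castV (δ h) := by
  funext i
  simp only [Finset.sum_apply, Pi.smul_apply, smul_eq_mul, castV, δ, Int.cast_ite, Int.cast_one, Int.cast_zero, mul_ite,
    mul_one, mul_zero]
  rw [Finset.sum_ite_eq]; simp

/-- The vertex coefficients of a coin block: `c_z = (1 − 2q_z)/2 ≥ 0`, `Σ_z c_z = ½`. -/
noncomputable def vcoef (q : ZMod 3 → ℝ) (z : ZMod 3) : ℝ := (1 - 2 * q z) / 2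

/-- The vertex coefficients of a coin block are non-negative. -/
theorem vcoef_nonneg {q : ZMod 3 → ℝ} (hq : IsCoinBlock q) (z : ZMod 3) : 0 ≤ vcoef q z := by
  unfold vcoef; linarith [hq.2.2 z]

/-- The vertex coefficients of a coin block sum to `1/2`. -/
theorem sum_vcoef {q : ZMod 3 → ℝ} (hq : IsCoinBlock q) : ∑ z : ZMod 3, vcoef q z = 1 / 2 := by
  rw [sum_zmod3 (fun z => vcoef q z)]
  simp only [vcoef]
  linarith [hq.2.1]

/-- **Vertex decomposition** of a coin block: `Q = Σ_z c_z Ṽ_z`. -/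
theorem circL_eq_sum_vtxL {q : ZMod 3 → ℝ} (hq : IsCoinBlock q) : circL q = ∑ z : ZMod 3, vcoef q z • vtxL z := by
  apply LinearMap.ext; intro v; funext h
  rw [LinearMap.sum_apply, Finset.sum_apply, sum_zmod3 (fun z => ((vcoef q z • vtxL z) v) h)]
  simp only [circL, vtxL, vcoef, LinearMap.coe_mk, AddHom.coe_mk, LinearMap.smul_apply, Pi.smul_apply, smul_eq_mul, sub_zero]
  linear_combination (v h + v (h - 1) + v (h - 2)) * hq.2.1

/-- The vertex words are bounded by 4 on basis vectors (from `threePairContractionZ` by casting). -/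
theorem vtxWord_basis_le (h z₁ r₁ z₂ r₂ z₃ r₃ : ZMod 3) :
    l1R (reflL r₃ (vtxL z₃ (reflL r₂ (vtxL z₂ (reflL r₁ (vtxL z₁ (castV (δ h)))))))) ≤ 4 := by
  rw [vtxL_castV, reflL_castV, vtxL_castV, reflL_castV, vtxL_castV, reflL_castV, l1R_castV]
  exact_mod_cast threePairContractionZ h z₁ r₁ z₂ r₂ z₃ r₃

/-- **LEMMA C over ℝ (PROVED): three (coin block, reflection) pairs halve the `ℓ¹` norm of every signed measure on `ℤ₃`.** -/
theorem threePairContraction {q₁ q₂ q₃ : ZMod 3 → ℝ} (hq₁ : IsCoinBlock q₁) (hq₂ : IsCoinBlock q₂) (hq₃ : IsCoinBlock q₃)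
    (r₁ r₂ r₃ : ZMod 3) (v : ZMod 3 → ℝ) :
    l1R (reflL r₃ (circL q₃ (reflL r₂ (circL q₂ (reflL r₁ (circL q₁ v)))))) ≤ 1 / 2 * l1R v := by
  -- the word as one linear map
  set Wd : (ZMod 3 → ℝ) →ₗ[ℝ] (ZMod 3 → ℝ) :=
    (reflL r₃) ∘ₗ (circL q₃) ∘ₗ (reflL r₂) ∘ₗ (circL q₂) ∘ₗ (reflL r₁) ∘ₗ (circL q₁) with hWd
  have hW : ∀ w, reflL r₃ (circL q₃ (reflL r₂ (circL q₂ (reflL r₁ (circL q₁ w))))) = Wd w := fun w => rfl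
  -- per basis vector
  have hbasis : ∀ h : ZMod 3, l1R (Wd (castV (δ h))) ≤ 1 / 2 := by
    intro h
    rw [← hW, circL_eq_sum_vtxL hq₁, circL_eq_sum_vtxL hq₂, circL_eq_sum_vtxL hq₃]
    simp only [LinearMap.sum_apply, LinearMap.smul_apply, map_sum, map_smul, Finset.smul_sum, smul_smul]
    have key : ∀ z₁ z₂ z₃ : ZMod 3,
        l1R ((vcoef q₁ z₁ * vcoef q₂ z₂ * vcoef q₃ z₃) •
            reflL r₃ (vtxL z₃ (reflL r₂ (vtxL z₂ (reflL r₁ (vtxL z₁ (castV (δ h))))))))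
          ≤ 4 * (vcoef q₁ z₁ * (vcoef q₂ z₂ * vcoef q₃ z₃)) := by
      intro z₁ z₂ z₃
      have h0 : 0 ≤ vcoef q₁ z₁ * vcoef q₂ z₂ * vcoef q₃ z₃ :=
        mul_nonneg (mul_nonneg (vcoef_nonneg hq₁ z₁) (vcoef_nonneg hq₂ z₂)) (vcoef_nonneg hq₃ z₃)
      rw [l1R_smul, abs_of_nonneg h0]
      nlinarith [vtxWord_basis_le h z₁ r₁ z₂ r₂ z₃ r₃]
    calc _ ≤ ∑ z₁ : ZMod 3, ∑ z₂ : ZMod 3, ∑ z₃ : ZMod 3, 4 * (vcoef q₁ z₁ * (vcoef q₂ z₂ * vcoef q₃ z₃)) :=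
          (l1R_sum_le _ _).trans (Finset.sum_le_sum fun z₁ _ => (l1R_sum_le _ _).trans
            (Finset.sum_le_sum fun z₂ _ => (l1R_sum_le _ _).trans (Finset.sum_le_sum fun z₃ _ => key z₁ z₂ z₃)))
      _ = 1 / 2 := by
          simp_rw [← Finset.mul_sum, sum_vcoef hq₃, ← Finset.sum_mul, sum_vcoef hq₂, sum_vcoef hq₁]; norm_num
  -- expand v in the basis
  have hv := eq_sum_basis v
  calc l1R (reflL r₃ (circL q₃ (reflL r₂ (circL q₂ (reflL r₁ (circL q₁ v))))))
      = l1R (Wd (∑ h : ZMod 3, v h • castV (δ h))) := by rw [hW, ← hv]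
    _ = l1R (∑ h : ZMod 3, v h • Wd (castV (δ h))) := by simp only [map_sum, map_smul]
    _ ≤ ∑ h : ZMod 3, l1R (v h • Wd (castV (δ h))) := l1R_sum_le _ _
    _ ≤ ∑ h : ZMod 3, |v h| * (1 / 2) := Finset.sum_le_sum fun h _ => by
          rw [l1R_smul]; exact mul_le_mul_of_nonneg_left (hbasis h) (abs_nonneg _)
    _ = 1 / 2 * l1R v := by rw [← Finset.sum_mul, ← l1R_eq_sum, mul_comm]


/-! ## 5. LEMMA C⁻ over the reals (W-S3, PROVED): two twisted coins contract mean-zero measures by ¾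

`tcoinL a` is TWICE the twisted coin `(I − S^a)/2`; `oreflL` an optional reflection.  Twisted coins map into the mean-zero plane, on which
the two-coin words contract: `‖E² T_b E¹ T_a E⁰ v‖₁ ≤ 3‖v‖₁ = ¾·2²·‖v‖₁`. -/

/-- Twice the twisted coin `I − S^a`. -/
noncomputable def tcoinL (a : ZMod 3) : (ZMod 3 → ℝ) →ₗ[ℝ] (ZMod 3 → ℝ) where
  toFun v := fun h => v h - v (h - a)
  map_add' v w := by
    funext h; simp only [Pi.add_apply]; ring
  map_smul' c v := by
    funext h; simp only [Pi.smul_apply, smul_eq_mul, RingHom.id_apply]; ring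

/-- Optional reflection as a linear map. -/
noncomputable def oreflL : Option (ZMod 3) → ((ZMod 3 → ℝ) →ₗ[ℝ] (ZMod 3 → ℝ))
  | none => LinearMap.id
  | some r => reflL r

/-- Coordinate sum (total mass). -/
def msum (v : ZMod 3 → ℝ) : ℝ := v 0 + v 1 + v 2

/-- Trichotomy in `ZMod 3`. -/
theorem zmod3_cases (h : ZMod 3) : h = 0 ∨ h = 1 ∨ h = 2 := by
  revert h; decide

/-- The three elements of `ZMod 3` are distinct. -/
theorem zmod3_ne : (0 : ZMod 3) ≠ 2 ∧ (2 : ZMod 3) ≠ 0 ∧ (1 : ZMod 3) ≠ 2 ∧ (2 : ZMod 3) ≠ 1 ∧ (0 : ZMod 3) ≠ 1 ∧ (1 : ZMod 3) ≠ 0 := by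
  decide

/-- Subtraction table of `ZMod 3`. -/
theorem zmod3_subs : (0 : ZMod 3) - 1 = 2 ∧ (1 : ZMod 3) - 1 = 0 ∧ (2 : ZMod 3) - 1 = 1 ∧
    (0 : ZMod 3) - 2 = 1 ∧ (1 : ZMod 3) - 2 = 2 ∧ (2 : ZMod 3) - 2 = 0 := by
  decide

/-- Twisted coins kill the total mass. -/
theorem msum_tcoinL (a : ZMod 3) (v : ZMod 3 → ℝ) : msum (tcoinL a v) = 0 := by
  obtain ⟨e1, e2, e3, f1, f2, f3⟩ := zmod3_subs
  rcases zmod3_cases a with rfl | rfl | rfl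
  · simp only [msum, tcoinL, LinearMap.coe_mk, AddHom.coe_mk, sub_zero]; ring
  · simp only [msum, tcoinL, LinearMap.coe_mk, AddHom.coe_mk, e1, e2, e3]; ring
  · simp only [msum, tcoinL, LinearMap.coe_mk, AddHom.coe_mk, f1, f2, f3]; ring

/-- `tcoinL` on integer vectors is `tcoin`. -/
theorem tcoinL_castV (a : ZMod 3) (v : ZMod 3 → ℤ) : tcoinL a (castV v) = castV (tcoin a v) := by
  funext h
  simp only [tcoinL, LinearMap.coe_mk, AddHom.coe_mk, castV, tcoin]
  push_cast; ring

/-- `oreflL` on integer vectors is `orefl`. -/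
theorem oreflL_castV (o : Option (ZMod 3)) (v : ZMod 3 → ℤ) : oreflL o (castV v) = castV (orefl o v) := by
  cases o with
  | none => rfl
  | some r => exact reflL_castV r v

/-- The integer difference vectors `δ_i − δ_j`. -/
def dZ (i j : ZMod 3) : ZMod 3 → ℤ := fun h => δ i h - δ j h

/-- The two-coin twisted words are bounded by 6 on the difference vectors (from `twistedTwoCoinContractionZ` by casting). -/
theorem twistedWord_diff_le {i j : ZMod 3} (hij : i ≠ j) (o₀ o₁ o₂ : Option (ZMod 3)) {a b : ZMod 3} (ha : a ≠ 0) (hb : b ≠ 0) :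
    l1R (oreflL o₂ (tcoinL b (oreflL o₁ (tcoinL a (oreflL o₀ (castV (dZ i j))))))) ≤ 6 := by
  rw [oreflL_castV, tcoinL_castV, oreflL_castV, tcoinL_castV, oreflL_castV, l1R_castV]
  exact_mod_cast twistedTwoCoinContractionZ i j hij o₀ o₁ o₂ a b ha hb

/-- Mean-zero decomposition along a same-sign pair: if `v_i, v_j` have the same sign and `v_k = −v_i − v_j` then
`v = v_i(δ_i − δ_k) + v_j(δ_j − δ_k)` and `‖v‖₁ = 2(|v_i| + |v_j|)`.  We use it with literal indices. -/
theorem twisted_aux (W : (ZMod 3 → ℝ) →ₗ[ℝ] (ZMod 3 → ℝ)) (hW : ∀ i j : ZMod 3, i ≠ j → l1R (W (castV (dZ i j))) ≤ 6)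
    (v : ZMod 3 → ℝ) (i j k : ZMod 3) (hik : i ≠ k) (hjk : j ≠ k)
    (hdec : v = v i • castV (dZ i k) + v j • castV (dZ j k)) (hnorm : 2 * (|v i| + |v j|) ≤ l1R v) :
    l1R (W v) ≤ 3 * l1R v := by
  have h1 : W v = v i • W (castV (dZ i k)) + v j • W (castV (dZ j k)) := by
    conv_lhs => rw [hdec]
    simp only [map_add, map_smul]
  rw [h1]
  calc l1R (v i • W (castV (dZ i k)) + v j • W (castV (dZ j k)))
      ≤ l1R (v i • W (castV (dZ i k))) + l1R (v j • W (castV (dZ j k))) := l1R_add_le _ _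
    _ = |v i| * l1R (W (castV (dZ i k))) + |v j| * l1R (W (castV (dZ j k))) := by rw [l1R_smul, l1R_smul]
    _ ≤ |v i| * 6 + |v j| * 6 := by
        gcongr
        · exact hW i k hik
        · exact hW j k hjk
    _ ≤ 3 * l1R v := by linarith

/-- **LEMMA C⁻ over ℝ (PROVED): from a mean-zero state, two twisted coins with arbitrary interleaved reflections contract `ℓ¹` by `¾`**
(in the doubled scaling: `‖E² T_b E¹ T_a E⁰ v‖₁ ≤ 3‖v‖₁`). -/
theorem twistedTwoCoinContraction (o₀ o₁ o₂ : Option (ZMod 3)) {a b : ZMod 3} (ha : a ≠ 0) (hb : b ≠ 0)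
    (v : ZMod 3 → ℝ) (hv : msum v = 0) :
    l1R (oreflL o₂ (tcoinL b (oreflL o₁ (tcoinL a (oreflL o₀ v))))) ≤ 3 * l1R v := by
  set W : (ZMod 3 → ℝ) →ₗ[ℝ] (ZMod 3 → ℝ) := (oreflL o₂) ∘ₗ (tcoinL b) ∘ₗ (oreflL o₁) ∘ₗ (tcoinL a) ∘ₗ (oreflL o₀) with hWdef
  have hWap : ∀ w, oreflL o₂ (tcoinL b (oreflL o₁ (tcoinL a (oreflL o₀ w)))) = W w := fun w => rfl
  have hW : ∀ i j : ZMod 3, i ≠ j → l1R (W (castV (dZ i j))) ≤ 6 := fun i j hij => by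
    rw [← hWap]; exact twistedWord_diff_le hij o₀ o₁ o₂ ha hb
  rw [hWap]
  have hv2 : v 2 = -v 0 - v 1 := by unfold msum at hv; linarith
  have hv1 : v 1 = -v 0 - v 2 := by linarith
  have hv0 : v 0 = -v 1 - v 2 := by linarith
  -- decompositions with literal indices
  obtain ⟨n02, n20, n12, n21, n01, n10⟩ := zmod3_ne
  have dec01 : v = v 0 • castV (dZ 0 2) + v 1 • castV (dZ 1 2) := by
    funext h; rcases zmod3_cases h with rfl | rfl | rfl <;> simp [castV, dZ, δ, n02, n20, n12, n21, n01, n10]; linarith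
  have dec02 : v = v 0 • castV (dZ 0 1) + v 2 • castV (dZ 2 1) := by
    funext h; rcases zmod3_cases h with rfl | rfl | rfl <;> simp [castV, dZ, δ, n02, n20, n12, n21, n01, n10]; linarith
  have dec12 : v = v 1 • castV (dZ 1 0) + v 2 • castV (dZ 2 0) := by
    funext h; rcases zmod3_cases h with rfl | rfl | rfl <;> simp [castV, dZ, δ, n02, n20, n12, n21, n01, n10]; linarith
  have hl1 : l1R v = |v 0| + |v 1| + |v 2| := rfl
  -- pick the same-sign pair
  rcases le_total 0 (v 0) with h0 | h0 <;> rcases le_total 0 (v 1) with h1 | h1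
  · -- v0, v1 ≥ 0
    refine twisted_aux W hW v 0 1 2 (by decide) (by decide) dec01 ?_
    rw [hl1, hv2, abs_of_nonneg h0, abs_of_nonneg h1, show -v 0 - v 1 = -(v 0 + v 1) by ring, abs_neg,
      abs_of_nonneg (by linarith : 0 ≤ v 0 + v 1)]; linarith
  · -- v0 ≥ 0 ≥ v1 : v2 pairs with one of them
    rcases le_total 0 (v 2) with h2 | h2
    · refine twisted_aux W hW v 0 2 1 (by decide) (by decide) dec02 ?_
      rw [hl1, abs_of_nonneg h0, abs_of_nonpos h1, abs_of_nonneg h2]; linarith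
    · refine twisted_aux W hW v 1 2 0 (by decide) (by decide) dec12 ?_
      rw [hl1, abs_of_nonneg h0, abs_of_nonpos h1, abs_of_nonpos h2]; linarith
  · rcases le_total 0 (v 2) with h2 | h2
    · refine twisted_aux W hW v 1 2 0 (by decide) (by decide) dec12 ?_
      rw [hl1, abs_of_nonpos h0, abs_of_nonneg h1, abs_of_nonneg h2]; linarith
    · refine twisted_aux W hW v 0 2 1 (by decide) (by decide) dec02 ?_
      rw [hl1, abs_of_nonpos h0, abs_of_nonneg h1, abs_of_nonpos h2]; linarith
  · refine twisted_aux W hW v 0 1 2 (by decide) (by decide) dec01 ?_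
    rw [hl1, hv2, abs_of_nonpos h0, abs_of_nonpos h1, abs_of_nonneg (by linarith : 0 ≤ -v 0 - v 1)]; linarith


end AffBells33

end Summit.QuantumAdvantage.AdviceFreeQNC0
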